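import Mathlib
import Literature.Combinatorics.Optimization.LPRelaxationsMaxCSP
import Literature.Combinatorics.Optimization.PatternMatrixRankUpperBounds
import HarnessLib

/-!
(TABLE MODULE 1/2 of the port: the matrix `C3`/`C3r`, the fooling set, the `decide`d support facts, `cover`, and the cone steps `rowstar_false`/`colstar_false`; the four statements of record `not_hasNonnegFactorization_seven`, `hasNonnegFactorization_eight`, `nonnegRank_C3`, `nonnegRank_ud3` are in `…RankPlusC3.lean` (2/2), split for the 400-line cap.)
# rank₊(C₃) = 8 — the 8 × 8 unique-disjointness value matrix has full nonnegative rank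
(THEOREMS PORT by val-port-4 g3, desk RULINGS #381/#382/#392: tree `Cruxes/NNDivisionHard/RankPlusC3.lean` @0d0b0597c8db, sha16 6519090840131395, bodies VERBATIM, namespace ↦ `…Theorems.NNDivisionHard.Calibration`, the in-file `#print axioms` guards dropped — axioms quoted on the press line. WORDS OF RECORD: CALIBRATION — the exact finite fact rank₊(C₃) = 8; the equality is NOT in print (arXiv:2605.14058 Table 9 has 7 ≤ rank₊(C₃) ≤ 8, cited for the bounds only); not law evidence.)
(kernel-checked certificate; cell val-cor-slack D-0160, custody lead g3; calibration instrument for crux stmt-ValiantsHypothesis-21181 `NNDivisionHard` — a finite exact fact, NOT law evidence)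

`C₃(a,b) = (1 − |a ∩ b|)²`, `a, b ⊆ {1,2,3}` — the Kaibel–Weltge / unique-disjointness submatrix of the slack matrix
of the correlation polytope `COR(3)` (rows: vertices `bbᵀ`; columns: the valid inequalities obtained by
multilinearising `(1 − Σ_{i∈a} x_i)² ≥ 0`).  `rank₊(C_n) = 2^n` for all `n` is Conjecture 4 of
Vandaele–Gillis–Glineur–Tuyttens (arXiv:1411.7245); `7 ≤ rank₊(C₃) ≤ 8` is the printed state of the case `n = 3`
(cf. arXiv:2605.14058, Table 9).  This file decides it: `rank₊(C₃) = 8`.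

## Main statements
* `nonnegRank_C3`  : `HasNonnegFactorization C3r 8 ∧ ∀ r, HasNonnegFactorization C3r r → 8 ≤ r` (table form);
* `nonnegRank_ud3` : the same for `ud3 a b = (1 − |a ∩ b|)²` on `Finset (Fin 3)` (set form);
* `not_hasNonnegFactorization_seven` : the lower bound `¬ HasNonnegFactorization C3r 7`.
`HasNonnegFactorization` is the tree's `Literature.Combinatorics.Optimization.HasNonnegFactorization`
(`M = Σ_{l<r} u_l v_lᵀ`, `u_l, v_l ≥ 0`).  Axioms: `propext`, `Classical.choice`, `Quot.sound` only (guarded below);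
no `native_decide`; the `decide` steps are pointwise statements over `Fin 8`/`Fin 7`/`Fin 6 → Bool` (largest: `cover`,
64 × 5 shape assignments).

## Certificate (val-cor-slack cell D-0160, lead g3; a NEW certificate shape, not the cover enumeration of record)
1. FOOLING SET `F = {(a, ā) : ∅ ≠ a ≠ 123} ∪ {(123,123)}` (`fa`, `fb`; `f_pos`, `f_fool`): in a nonnegative
   factorisation with 7 terms every term owns exactly one cell of `F` (`own`, a bijection `Fin 7 → Fin 7`).
2. SHAPE DICHOTOMY (`dich6`): the owner of `(a, ā)` has row support `⊆ {∅, a}` ("row type") or column support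
   `⊆ {∅, ā}` ("column type"); the owner of `(123,123)` (`dich7`, `supp7`) is of row type `{∅,123} × ·`, of column
   type, or a principal block on `{∅, k, 123}`, `|k| = 2`.
3. COVER (`cover`, by `decide`): among the `2⁶ × 5` shape assignments only ROW STAR (all row type) and COLUMN STAR
   (all column type) cover `supp C₃`.
4. CONE STEP (`rowstar_false`, `colstar_false`): in the row star each nonempty row `a` is carried by its owner alone,
   so the all-ones row `C₃[∅,·]` is a nonnegative combination `Σ_a d_a C₃[a,·]`; pairing with `y(b) = 4, −2, 0, −1`
   for `|b| = 0,1,2,3` (columns `∅,{1},{2},{3},{123}` suffice) gives `−3 = d_{12} + d_{13} + d_{23} ≥ 0`. `linarith`.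
   The column star is the transpose.

Finite exact fact / calibration instrument for the cell's law tests — NOT evidence for any asymptotic law;
VP ≠ VNP is NOT proved here or anywhere in this cell.
-/

set_option linter.dupNamespace false

open Finset
open Literature.Combinatorics.Optimization (HasNonnegFactorization)

namespace Summit.ValiantsHypothesis.ValiantsHypothesis.Theorems.NNDivisionHard.Calibration

/-- `C₃` as an explicit table. Index `i : Fin 8` encodes the subset `{k+1 : bit k of i is set}` of `{1,2,3}`:
0 = ∅, 1 = {1}, 2 = {2}, 3 = {1,2}, 4 = {3}, 5 = {1,3}, 6 = {2,3}, 7 = {1,2,3}. Entry = (1 − |a ∩ b|)². -/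
def C3 : Fin 8 → Fin 8 → ℕ :=
  ![![1, 1, 1, 1, 1, 1, 1, 1],
    ![1, 0, 1, 0, 1, 0, 1, 0],
    ![1, 1, 0, 0, 1, 1, 0, 0],
    ![1, 0, 0, 1, 1, 0, 0, 1],
    ![1, 1, 1, 1, 0, 0, 0, 0],
    ![1, 0, 1, 0, 0, 1, 0, 1],
    ![1, 1, 0, 0, 0, 0, 1, 1],
    ![1, 0, 0, 1, 0, 1, 1, 4]]

/-- the real matrix -/
def C3r (i j : Fin 8) : ℝ := C3 i j

/-- bit-count of the bitwise AND, by table (= |a ∩ b| under the encoding) -/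
def interCard : Fin 8 → Fin 8 → ℕ :=
  fun a b => ((Nat.land a.val b.val).testBit 0).toNat + ((Nat.land a.val b.val).testBit 1).toNat +
    ((Nat.land a.val b.val).testBit 2).toNat

/-- meaning of the table: `C3 a b = (1 − |a ∩ b|)²` (computed in ℤ). -/
theorem C3_eq : ∀ a b : Fin 8, (C3 a b : ℤ) = (1 - (interCard a b : ℤ)) ^ 2 := by decide

/-! ## the fooling set: cells (a, ā) for the six proper nonempty a, and (123,123) -/
/-- Row indices of the fooling set `F` (the nonempty rows `1..7`). -/
def fa : Fin 7 → Fin 8 := ![1, 2, 3, 4, 5, 6, 7]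
/-- Column indices of the fooling set `F` (the complements `6..1`, and `7`). -/
def fb : Fin 7 → Fin 8 := ![6, 5, 4, 3, 2, 1, 7]

/-- Every fooling-set cell is non-zero. -/
theorem f_pos : ∀ t : Fin 7, C3 (fa t) (fb t) ≠ 0 := by decide

/-- The fooling property: two distinct fooling cells are never covered by one rank-one nonnegative term. -/
theorem f_fool : ∀ t t' : Fin 7, t ≠ t' → C3 (fa t) (fb t') = 0 ∨ C3 (fa t') (fb t) = 0 := by decide

/-- `fa t = t + 1`. -/
theorem fa_succ : ∀ t : Fin 7, (fa t).val = t.val + 1 := by decide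

/-! ## support-shape dichotomies (pointwise, decidable) -/
/-- Shape dichotomy for the owner of `(a, ā)`, `a ≠ 123`: row type or column type. -/
theorem dich6 : ∀ t : Fin 7, t ≠ 6 → ∀ i j : Fin 8, C3 i (fb t) ≠ 0 → C3 (fa t) j ≠ 0 → C3 i j ≠ 0 →
    (i = 0 ∨ i = fa t) ∨ (j = 0 ∨ j = fb t) := by decide

/-- Shape trichotomy for the owner of `(123,123)`. -/
theorem dich7 : ∀ i j : Fin 8, C3 i 7 ≠ 0 → C3 7 j ≠ 0 → C3 i j ≠ 0 →
    i ≠ 0 → i ≠ 7 → j ≠ 0 → j ≠ 7 → i = j := by decide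

/-- The non-zero rows of column `123` other than `∅`, `123` are the three 2-sets. -/
theorem supp7 : ∀ i : Fin 8, C3 i 7 ≠ 0 → i ≠ 0 → i ≠ 7 → i = 3 ∨ i = 5 ∨ i = 6 := by decide

/-- `C₃` is symmetric. -/
theorem C3_symm : ∀ i j : Fin 8, C3 i j = C3 j i := by decide

/-! ## the covering lemma: shapes of the seven owner terms -/
/-- membership of cell (i,j) in the enclosing rectangle of the term owning fooling cell `t`, given the shape bits
`c t` (for t < 6: `false` = row type `{∅, a_t} × supp(row a_t)`, `true` = column type) and the 5-way type `r` of the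
seventh term (0 = row type, 4 = column type, 1/2/3 = the square `{∅, k, 123}²` for k = {1,2}, {1,3}, {2,3}). -/
def rectB (c : Fin 7 → Bool) (r : Fin 5) (t : Fin 7) (i j : Fin 8) : Bool :=
  if t = 6 then
    (if r = 0 then ((i == 0 || i == 7) && C3 7 j != 0)
     else if r = 4 then (C3 i 7 != 0 && (j == 0 || j == 7))
     else if r = 1 then ((i == 0 || i == 3 || i == 7) && (j == 0 || j == 3 || j == 7))
     else if r = 2 then ((i == 0 || i == 5 || i == 7) && (j == 0 || j == 5 || j == 7))
     else ((i == 0 || i == 6 || i == 7) && (j == 0 || j == 6 || j == 7)))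
  else
    (if c t then (C3 i (fb t) != 0 && (j == 0 || j == fb t)) else ((i == 0 || i == fa t) && C3 (fa t) j != 0))

/-- COVER: among the `2⁶ × 5` shape assignments only the row star and the column star cover `supp C₃` (by `decide`). -/
theorem cover : ∀ c : Fin 6 → Bool, ∀ r : Fin 5,
    (∀ i j : Fin 8, C3 i j ≠ 0 → ∃ t : Fin 7, rectB (fun t => if h : t.val < 6 then c ⟨t.val, h⟩ else false) r t i j = true) →
    (c = (fun _ => false) ∧ r = 0) ∨ (c = (fun _ => true) ∧ r = 4) := by
  decide


/-! ## auxiliary decidable facts used by the linear-algebra endgame -/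
/-- No fooling row is the empty set. -/
theorem fa_ne_zero : ∀ t : Fin 7, fa t ≠ 0 := by decide
/-- No fooling column is the empty set. -/
theorem fb_ne_zero : ∀ t : Fin 7, fb t ≠ 0 := by decide
/-- `fa` is injective. -/
theorem fa_inj : ∀ t t' : Fin 7, fa t = fa t' → t = t' := by decide
/-- `fb` is injective. -/
theorem fb_inj : ∀ t t' : Fin 7, fb t = fb t' → t = t' := by decide

/-! ## the two star configurations are infeasible (cone argument with dual vector y = (4,−2,0,−1) by |b|) -/

/-- ROW STAR: if every term's row support is inside `{∅, a_t}` (term `own t` owning fooling cell `t`), the all-ones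
row `C₃[∅,·]` would be a nonnegative combination of the rows `C₃[a,·]`, `a ≠ ∅` — impossible. -/
theorem rowstar_false (U : Fin 8 → Fin 7 → ℝ) (V : Fin 7 → Fin 8 → ℝ) (hU : ∀ i l, 0 ≤ U i l)
    (hM : ∀ i j, C3r i j = ∑ l, U i l * V l j) (own : Fin 7 → Fin 7) (hbij : Function.Bijective own)
    (hpos : ∀ t, 0 < U (fa t) (own t)) (hRow : ∀ t i, 0 < U i (own t) → i = 0 ∨ i = fa t) : False := by
  -- off-owner entries of the nonempty rows vanish
  have hoff : ∀ t t', t' ≠ t → U (fa t) (own t') = 0 := by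
    intro t t' hne
    rcases (hU (fa t) (own t')).eq_or_lt with h | h
    · exact h.symm
    · rcases hRow t' (fa t) h with h0 | h1
      · exact absurd h0 (fa_ne_zero t)
      · exact absurd (fa_inj t t' h1) (Ne.symm hne)
  -- nonempty rows are single terms
  have hrow : ∀ t j, C3r (fa t) j = U (fa t) (own t) * V (own t) j := by
    intro t j
    rw [hM, Finset.sum_eq_single (own t)]
    · intro l _ hl
      obtain ⟨t', rfl⟩ := hbij.2 l
      have : t' ≠ t := fun h => hl (by rw [h])
      rw [hoff t t' this, zero_mul]
    · intro h; exact absurd (Finset.mem_univ _) h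
  -- the all-ones row, re-indexed over owners
  have hone : ∀ j, (1 : ℝ) = ∑ t, U 0 (own t) * V (own t) j := by
    intro j
    have h1 : C3r 0 j = 1 := by
      fin_cases j <;> simp [C3r, C3]
    rw [← h1, hM]
    exact (hbij.sum_comp (fun l => U 0 l * V l j)).symm
  -- substitute V (own t) j = C3r (fa t) j / U (fa t) (own t)
  set d : Fin 7 → ℝ := fun t => U 0 (own t) / U (fa t) (own t) with hd
  have hdnn : ∀ t, 0 ≤ d t := fun t => div_nonneg (hU 0 (own t)) (hpos t).le
  have hV : ∀ t j, V (own t) j = C3r (fa t) j / U (fa t) (own t) := by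
    intro t j
    rw [eq_div_iff (hpos t).ne', hrow t j]; ring
  have hcol : ∀ j, (1 : ℝ) = ∑ t, d t * C3r (fa t) j := by
    intro j
    rw [hone j]
    refine Finset.sum_congr rfl fun t _ => ?_
    rw [hV t j, hd]
    beta_reduce
    rw [div_mul_eq_mul_div, mul_div_assoc]
  have e0 := hcol 0
  have e1 := hcol 1
  have e2 := hcol 2
  have e4 := hcol 4
  have e7 := hcol 7
  simp [Fin.sum_univ_seven, C3r, C3, fa] at e0 e1 e2 e4 e7
  have h0 := hdnn 0; have h1 := hdnn 1; have h2 := hdnn 2; have h3 := hdnn 3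
  have h4 := hdnn 4; have h5 := hdnn 5; have h6 := hdnn 6
  linarith

/-- COLUMN STAR: the transpose situation. -/
theorem colstar_false (U : Fin 8 → Fin 7 → ℝ) (V : Fin 7 → Fin 8 → ℝ) (hV : ∀ l j, 0 ≤ V l j)
    (hM : ∀ i j, C3r i j = ∑ l, U i l * V l j) (own : Fin 7 → Fin 7) (hbij : Function.Bijective own)
    (hpos : ∀ t, 0 < V (own t) (fb t)) (hCol : ∀ t j, 0 < V (own t) j → j = 0 ∨ j = fb t) : False := by
  have hoff : ∀ t t', t' ≠ t → V (own t') (fb t) = 0 := by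
    intro t t' hne
    rcases (hV (own t') (fb t)).eq_or_lt with h | h
    · exact h.symm
    · rcases hCol t' (fb t) h with h0 | h1
      · exact absurd h0 (fb_ne_zero t)
      · exact absurd (fb_inj t t' h1) (Ne.symm hne)
  have hcolumn : ∀ t i, C3r i (fb t) = U i (own t) * V (own t) (fb t) := by
    intro t i
    rw [hM, Finset.sum_eq_single (own t)]
    · intro l _ hl
      obtain ⟨t', rfl⟩ := hbij.2 l
      have : t' ≠ t := fun h => hl (by rw [h])
      rw [hoff t t' this, mul_zero]
    · intro h; exact absurd (Finset.mem_univ _) h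
  have hone : ∀ i, (1 : ℝ) = ∑ t, U i (own t) * V (own t) 0 := by
    intro i
    have h1 : C3r i 0 = 1 := by
      fin_cases i <;> simp [C3r, C3]
    rw [← h1, hM]
    exact (hbij.sum_comp (fun l => U i l * V l 0)).symm
  set d : Fin 7 → ℝ := fun t => V (own t) 0 / V (own t) (fb t) with hd
  have hdnn : ∀ t, 0 ≤ d t := fun t => div_nonneg (hV (own t) 0) (hpos t).le
  have hU' : ∀ t i, U i (own t) = C3r i (fb t) / V (own t) (fb t) := by
    intro t i
    rw [eq_div_iff (hpos t).ne', hcolumn t i]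
  have hrow : ∀ i, (1 : ℝ) = ∑ t, d t * C3r i (fb t) := by
    intro i
    rw [hone i]
    refine Finset.sum_congr rfl fun t _ => ?_
    rw [hU' t i, hd]
    beta_reduce
    rw [div_mul_eq_mul_div, div_mul_eq_mul_div, mul_comm]
  have e0 := hrow 0
  have e1 := hrow 1
  have e2 := hrow 2
  have e4 := hrow 4
  have e7 := hrow 7
  simp [Fin.sum_univ_seven, C3r, C3, fb] at e0 e1 e2 e4 e7
  have h0 := hdnn 0; have h1 := hdnn 1; have h2 := hdnn 2; have h3 := hdnn 3
  have h4 := hdnn 4; have h5 := hdnn 5; have h6 := hdnn 6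
  linarith

/-! ## the main theorem -/


end Summit.ValiantsHypothesis.ValiantsHypothesis.Theorems.NNDivisionHard.Calibration
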